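import Literature.NumberTheory.EllipticCurves.PeriodLatticePresentationProofs
import Literature.NumberTheory.EllipticCurves.ModularFunctionFieldPointValues
import HarnessLib

/-!
# The modular function `x = ℘_Λ(2πi∫f)` as an element of `K_N`: values and poles at the points of `ℍ`

Topic `NumberTheory/EllipticCurves` (fifth file of the "canonical model of `X₀(N)` at CM points"
chain).  Let `f ∈ S₂(Γ₀(N))` be nonzero, `u = 2πi∫_{i∞} f` its Eichler integral and `Λ = Λ(L)` a
lattice containing the period lattice `Λ_f`, so that `x(τ) = ℘_Λ(u(τ))` is a `Γ₀(N)`-invariant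
meromorphic function on `ℍ` — the `x`-coordinate of the analytic modular parametrisation
`τ ↦ (℘_Λ(u), ℘_Λ'(u))` of `ℂ/Λ` (Shimura 1971, Thm. 7.14; Cremona 1997, §2.10).

* `exists_presentation_gamma0` — the tree's presentation
  `exists_weierstrassP_eichlerIntegral_presentation_twelve_le` (`PeriodLatticePresentationProofs`)
  descended from diamond-invariant `Γ₁(N)`-forms to `Γ₀(N)`: **there are cusp forms
  `F, G ∈ S_k(Γ₀(N))`, `G ≠ 0`, with `℘_Λ(u(τ))·G(τ) = F(τ)` off the poles** (`descendGamma0`).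
* `IsXPresentation f L F G` — the predicate "`(F, G)` presents `x`", and for such a pair the
  element `xFn F G = F/G ∈ K_N` (`mkFn`).
* **Values** (`pointValuation_xFn_sub_lt_one`): if `u(τ) ∉ Λ` then `F/G ∈ O_{P_τ}` with value
  `℘_Λ(u(τ))`, i.e. `v_τ(F/G − ℘_Λ(u(τ))) < 1` (locally `F − cG = (℘_Λ∘u − c)·G`, so `F − cG`
  vanishes to higher order than `G` exactly when `c = ℘_Λ(u(τ))`; analytic orders are additive).
* **Poles** (`pointValuation_xFn_inv_lt_one`, `eichlerIntegral_notMem_of_xFn_mem`): if `u(τ) ∈ Λ`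
  then `ord_τ F = ord_τ G − 2m < ord_τ G` (`m = ord_τ(u − u(τ)) ≥ 1`,
  `meromorphicOrderAt_weierstrassP_eichlerIntegral`), so `(F/G)⁻¹ ∈ m_{P_τ}` and `F/G ∉ O_{P_τ}`;
  consequently **`F/G ∈ O_{P_τ}` iff `u(τ) ∉ Λ`** (`xFn_mem_pointPlace_iff`).

Everything is proved; no named facts are introduced (Diamond–Shurman 2005, §3.2 for orders of
quotients of forms; Silverman AEC VI.3 for `℘`).

## References

* G. Shimura, *Introduction to the arithmetic theory of automorphic functions*, 1971, §2.4,
  Thm. 7.14. [ShimuraIATAF1971]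
* J. E. Cremona, *Algorithms for modular elliptic curves*, 2nd ed., 1997, §2.10.
  [CremonaAlgorithms1997]
* F. Diamond, J. Shurman, *A First Course in Modular Forms*, GTM 228, 2005, §3.2.
  [DiamondShurman2005]
-/

noncomputable section

open Complex Filter Topology Set Function
open UpperHalfPlane hiding I
open scoped Real Topology Manifold MatrixGroups PeriodPair ModularForm WithZero
open ModularForm CongruenceSubgroup

open Literature.NumberTheory.EllipticCurves

namespace Literature.NumberTheory.EllipticCurves.ModularForms

variable {N : ℕ} [NeZero N] {k : ℤ}

/-! ### Descent of diamond-invariant `Γ₁(N)`-cusp forms to `Γ₀(N)` -/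

/-- A diamond-invariant cusp form on `Γ₁(N)` *is* a cusp form on `Γ₀(N)` (same function;
`apply_smul_eq_of_diamondOp_eq` for the invariance, and `Γ₀(N)`, `Γ₁(N)` have the same cusps).
[folklore] -/
def descendGamma0 (F : CuspForm (Gamma1 N) k) (hF : ∀ d : (ZMod N)ˣ, diamondOp N k (d : ZMod N) F = F) :
    CuspForm (Gamma0 N) k where
  toFun := F
  slash_action_eq' := fun A hA ↦ by
    obtain ⟨γ, hγ, rfl⟩ := hA
    change (⇑F) ∣[k] γ = ⇑F
    funext τ
    rw [ModularForm.SL_slash_apply, apply_smul_eq_of_diamondOp_eq F hF ⟨γ, hγ⟩ τ, mul_assoc,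
      ← zpow_add₀ (denom_ne_zero _ τ), add_neg_cancel, zpow_zero, mul_one]
  holo' := F.holo'
  zero_at_cusps' := fun {c} hc ↦ by
    rw [Subgroup.IsArithmetic.isCusp_iff_isCusp_SL2Z] at hc
    exact F.zero_at_cusps' ((Subgroup.IsArithmetic.isCusp_iff_isCusp_SL2Z _).mpr hc)

/-- `descendGamma0` does not change the function. [folklore] -/
@[simp] theorem coe_descendGamma0 (F : CuspForm (Gamma1 N) k)
    (hF : ∀ d : (ZMod N)ˣ, diamondOp N k (d : ZMod N) F = F) :
    (⇑(descendGamma0 F hF) : ℍ → ℂ) = ⇑F := rfl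

/-- **Presentation of `℘_Λ(2πi∫f)` by `Γ₀(N)`-cusp forms**: for `f ≠ 0` and `Λ ⊇ Λ_f` there are
`F, G ∈ S_k(Γ₀(N))` (`k ≥ 12`), `G ≠ 0`, with `℘_Λ(u(τ))G(τ) = F(τ)` whenever `u(τ) ∉ Λ` (the
tree's `exists_weierstrassP_eichlerIntegral_presentation_twelve_le`, descended).
[cite: ShimuraIATAF1971, §2.4] -/
theorem exists_presentation_gamma0 (f : CuspForm (Gamma0 N) 2) (hf : f ≠ 0) (L : PeriodPair)
    (hΛ : ∀ x ∈ periodLattice f, x ∈ L.lattice) :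
    ∃ (k : ℤ) (F G : CuspForm (Gamma0 N) k), 12 ≤ k ∧ G ≠ 0 ∧
      ∀ τ : ℍ, eichlerIntegral f τ ∉ L.lattice → ℘[L] (eichlerIntegral f τ) * G τ = F τ := by
  obtain ⟨k, F₁, G₁, hk, hG₁, hFd, hGd, hFG⟩ :=
    exists_weierstrassP_eichlerIntegral_presentation_twelve_le f hf L hΛ
  refine ⟨k, descendGamma0 F₁ hFd, descendGamma0 G₁ hGd, hk, fun h0 ↦ hG₁ ?_, fun τ hτ ↦ hFG τ hτ⟩
  apply DFunLike.ext
  intro τ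
  have := DFunLike.congr_fun h0 τ
  exact this

/-! ### The predicate "`(F, G)` presents `x`" and the element `F/G ∈ K_N` -/

/-- `IsXPresentation f L F G`: the cusp forms `F, G ∈ S_k(Γ₀(N))` present the modular function
`x = ℘_Λ(2πi∫f)`: `G ≠ 0` and `℘_Λ(u(τ))G(τ) = F(τ)` off the poles. [folklore] -/
def IsXPresentation (f : CuspForm (Gamma0 N) 2) (L : PeriodPair) (F G : CuspForm (Gamma0 N) k) : Prop :=
  G ≠ 0 ∧ ∀ τ : ℍ, eichlerIntegral f τ ∉ L.lattice → ℘[L] (eichlerIntegral f τ) * G τ = F τ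

namespace IsXPresentation

variable {f : CuspForm (Gamma0 N) 2} {L : PeriodPair} {F G : CuspForm (Gamma0 N) k}

omit [NeZero N] in
/-- The denominator, as a modular form, is nonzero. [folklore] -/
theorem modularForm_ne_zero (h : IsXPresentation f L F G) : (G : ModularForm (Gamma0 N) k) ≠ 0 := by
  intro h0; apply h.1; apply DFunLike.ext; intro τ
  exact DFunLike.congr_fun h0 τ

/-- **The element `x = F/G ∈ K_N`** of a presentation. [folklore] -/
def xFn (_h : IsXPresentation f L F G) : modularFunctionField N :=
  mkFn (F : ModularForm (Gamma0 N) k) (G : ModularForm (Gamma0 N) k) _h.modularForm_ne_zero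

omit [NeZero N] in
/-- Unfolding of `xFn`. [folklore] -/
theorem xFn_def (h : IsXPresentation f L F G) :
    h.xFn = mkFn (F : ModularForm (Gamma0 N) k) (G : ModularForm (Gamma0 N) k) h.modularForm_ne_zero :=
  rfl

/-! ### Local analysis: `F − cG = (℘∘u − c)·G` near a regular point -/

omit [NeZero N] in
/-- Off the poles, `F = x·G` on the half-plane (as functions of the complex variable). [folklore] -/
theorem apply_eq_mul (h : IsXPresentation f L F G) {z : ℂ}
    (hzL : eichlerIntegral f (ofComplex z) ∉ L.lattice) :
    (⇑F ∘ ofComplex) z = ℘[L] (eichlerIntegral f (ofComplex z)) * (⇑G ∘ ofComplex) z := by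
  simp only [comp_apply]
  exact (h.2 _ hzL).symm

/-- Near a point `z₀` with `u(z₀) ∉ Λ`, `F − cG` agrees with `(x − c)·G`. [folklore] -/
theorem sub_smul_eventuallyEq (h : IsXPresentation f L F G) (c : ℂ) {z₀ : ℂ} (hz₀ : 0 < z₀.im)
    (hz₀L : eichlerIntegral f (ofComplex z₀) ∉ L.lattice) :
    (⇑((F : ModularForm (Gamma0 N) k) - c • (G : ModularForm (Gamma0 N) k)) ∘ ofComplex) =ᶠ[𝓝 z₀]
      (fun z ↦ ℘[L] (eichlerIntegral f (ofComplex z)) - c) * (⇑G ∘ ofComplex) := by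
  have hΩ : {z : ℂ | 0 < z.im ∧ eichlerIntegral f (ofComplex z) ∉ L.lattice} ∈ 𝓝 z₀ :=
    (isOpen_setOf_eichlerIntegral_notMem_lattice f L).mem_nhds ⟨hz₀, hz₀L⟩
  filter_upwards [hΩ] with z hz
  have hFz : ((F : ModularForm (Gamma0 N) k) : ℍ → ℂ) = ⇑F := rfl
  have hGz : ((G : ModularForm (Gamma0 N) k) : ℍ → ℂ) = ⇑G := rfl
  simp only [comp_apply, Pi.mul_apply, ModularForm.coe_sub, Pi.sub_apply,
    ModularForm.IsGLPos.smul_apply, smul_eq_mul, hFz, hGz]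
  rw [← h.2 _ hz.2]; ring

/-- **Value of `x = F/G` at a regular point**: if `u(τ) ∉ Λ` then `v_τ(F/G − ℘_Λ(u(τ))) < 1` — so
`F/G ∈ O_{P_τ}` with value `℘_Λ(u(τ))`. [folklore] -/
theorem pointValuation_xFn_sub_lt_one (h : IsXPresentation f L F G) (τ : ℍ)
    (hτ : eichlerIntegral f τ ∉ L.lattice) :
    pointValuation (N := N) τ (h.xFn - algebraMap ℂ (modularFunctionField N) (℘[L] (eichlerIntegral f τ))) < 1 := by
  set c := ℘[L] (eichlerIntegral f τ) with hc
  apply pointValuation_mkFn_sub_lt_one_of_orderAt_lt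
  set H : ModularForm (Gamma0 N) k := (F : ModularForm (Gamma0 N) k) - c • (G : ModularForm (Gamma0 N) k)
    with hH
  by_cases hH0 : H = 0
  · exact Or.inl hH0
  right
  have hG0 := h.modularForm_ne_zero
  set z₀ : ℂ := (τ : ℂ) with hz₀
  have hz₀im : 0 < z₀.im := τ.im_pos
  have hz₀L : eichlerIntegral f (ofComplex z₀) ∉ L.lattice := by rwa [hz₀, ofComplex_apply]
  -- analytic orders at `z₀`
  have hXan : AnalyticAt ℂ (fun z ↦ ℘[L] (eichlerIntegral f (ofComplex z)) - c) z₀ :=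
    (analyticOnNhd_weierstrassP_eichlerIntegral f L z₀ ⟨hz₀im, hz₀L⟩).sub analyticAt_const
  have hGan : AnalyticAt ℂ (⇑G ∘ ofComplex) z₀ := (isCuspFunction_one G).analyticAt_comp_ofComplex hz₀im
  have hHeq := h.sub_smul_eventuallyEq c hz₀im hz₀L
  have hordH : (orderAt H τ : ℕ∞) = analyticOrderAt (fun z ↦ ℘[L] (eichlerIntegral f (ofComplex z)) - c) z₀ +
      analyticOrderAt (⇑G ∘ ofComplex) z₀ := by
    rw [orderAt_eq hH0, hz₀, analyticOrderAt_congr hHeq, analyticOrderAt_mul hXan hGan]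
  have hordG : (orderAt (G : ModularForm (Gamma0 N) k) τ : ℕ∞) = analyticOrderAt (⇑G ∘ ofComplex) z₀ :=
    orderAt_eq hG0 τ
  -- the first factor vanishes at `z₀`
  have hpos : 0 < analyticOrderAt (fun z ↦ ℘[L] (eichlerIntegral f (ofComplex z)) - c) z₀ := by
    rw [pos_iff_ne_zero, Ne, hXan.analyticOrderAt_eq_zero]
    simp [hc, hz₀, ofComplex_apply]
  -- finiteness of the orders
  have hfinG : analyticOrderAt (⇑G ∘ ofComplex) z₀ ≠ ⊤ := by rw [← hordG]; exact ENat.coe_ne_top _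
  have hfinX : analyticOrderAt (fun z ↦ ℘[L] (eichlerIntegral f (ofComplex z)) - c) z₀ ≠ ⊤ := by
    intro htop
    rw [htop, top_add] at hordH
    exact ENat.coe_ne_top _ hordH
  obtain ⟨n₁, hn₁⟩ := ENat.ne_top_iff_exists.mp hfinX
  obtain ⟨n₂, hn₂⟩ := ENat.ne_top_iff_exists.mp hfinG
  rw [← hn₁, ← hn₂, ← ENat.coe_add, Nat.cast_inj] at hordH
  rw [← hn₂, Nat.cast_inj] at hordG
  rw [← hn₁] at hpos
  have hn₁pos : 0 < n₁ := by exact_mod_cast hpos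
  change orderAt (G : ModularForm (Gamma0 N) k) τ < orderAt H τ
  omega

/-- If `u(τ) ∉ Λ` then `F/G ∈ O_{P_τ}`. [folklore] -/
theorem xFn_mem_pointPlace (h : IsXPresentation f L F G) (τ : ℍ)
    (hτ : eichlerIntegral f τ ∉ L.lattice) : h.xFn ∈ (pointPlace (N := N) τ).toValuationSubring :=
  mem_pointPlace_of_pointValuation_sub_lt_one (h.pointValuation_xFn_sub_lt_one τ hτ)

/-! ### Local analysis at a pole -/

omit [NeZero N] in
/-- A modular form vanishing near a point of the half-plane vanishes (identity theorem). [folklore] -/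
theorem modularForm_eq_zero_of_eventuallyEq_zero {G : ModularForm (Gamma0 N) k} {z : ℂ} (hz : 0 < z.im)
    (h0 : ∀ᶠ w in 𝓝 z, (⇑G ∘ ofComplex) w = 0) : G = 0 := by
  have han : AnalyticOnNhd ℂ (⇑G ∘ ofComplex) {w : ℂ | 0 < w.im} := fun w hw ↦
    analyticAt_comp_ofComplex (ModularFormClass.holo G) ⟨w, hw⟩
  have heq := han.eqOn_zero_of_preconnected_of_eventuallyEq_zero convex_setOf_im_pos.isPreconnected hz h0
  apply DFunLike.ext
  intro τ
  have := heq τ.im_pos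
  simpa [comp_apply, ofComplex_apply] using this

/-- The numerator of a presentation is nonzero (for `f ≠ 0`): otherwise `x·G = 0` off the poles,
forcing either `G = 0` near a point where `x ≠ 0` or `x ≡ 0` on the regular set, both impossible
(`not_const_weierstrassP_eichlerIntegral`). [folklore] -/
theorem numerator_ne_zero (h : IsXPresentation f L F G) (hf : f ≠ 0) :
    (F : ModularForm (Gamma0 N) k) ≠ 0 := by
  intro hF0
  have hG0 := h.modularForm_ne_zero
  set Ω : Set ℂ := {z : ℂ | 0 < z.im ∧ eichlerIntegral f (ofComplex z) ∉ L.lattice} with hΩ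
  have hΩo : IsOpen Ω := isOpen_setOf_eichlerIntegral_notMem_lattice f L
  -- a regular point
  obtain ⟨T, hT⟩ := exists_forall_eichlerIntegral_smul_notMem f hf L 1
  set z₁ : ℂ := ((max T 1 + 1 : ℝ) : ℂ) * Complex.I with hz₁
  have hz₁im : z₁.im = max T 1 + 1 := by simp [hz₁]
  have hz₁pos : 0 < z₁.im := by rw [hz₁im]; positivity
  set τ₁ : ℍ := ⟨z₁, hz₁pos⟩ with hτ₁
  have hτ₁Ω : z₁ ∈ Ω := by
    refine ⟨hz₁pos, ?_⟩
    have h1 := hT τ₁ (by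
      change T ≤ z₁.im
      rw [hz₁im]; linarith [le_max_left T 1])
    rw [one_smul] at h1
    rwa [show ofComplex z₁ = τ₁ from ofComplex_apply_of_im_pos hz₁pos]
  -- `x·G = 0` on `Ω`
  have hxG : ∀ z ∈ Ω, ℘[L] (eichlerIntegral f (ofComplex z)) * (⇑G ∘ ofComplex) z = 0 := by
    intro z hz
    rw [← h.apply_eq_mul hz.2, comp_apply]
    have : (⇑F : ℍ → ℂ) = ⇑(F : ModularForm (Gamma0 N) k) := rfl
    rw [this, hF0]
    rfl
  have hXan : AnalyticOnNhd ℂ (fun z ↦ ℘[L] (eichlerIntegral f (ofComplex z))) Ω :=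
    analyticOnNhd_weierstrassP_eichlerIntegral f L
  by_cases hW : ∃ z ∈ Ω, ℘[L] (eichlerIntegral f (ofComplex z)) ≠ 0
  · obtain ⟨z, hzΩ, hxz⟩ := hW
    have hGz : ∀ᶠ w in 𝓝 z, (⇑(G : ModularForm (Gamma0 N) k) ∘ ofComplex) w = 0 := by
      have hne : ∀ᶠ w in 𝓝 z, ℘[L] (eichlerIntegral f (ofComplex w)) ≠ 0 :=
        (hXan z hzΩ).continuousAt.eventually_ne hxz
      filter_upwards [hne, hΩo.mem_nhds hzΩ] with w hw hwΩ
      exact (mul_eq_zero.mp (hxG w hwΩ)).resolve_left hw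
    exact hG0 (modularForm_eq_zero_of_eventuallyEq_zero hzΩ.1 hGz)
  · push Not at hW
    exact not_const_weierstrassP_eichlerIntegral f hf L hΩo ⟨z₁, hτ₁Ω⟩ (fun z hz ↦ hz) 0 hW

/-- The order of vanishing of `u − u(τ)` at a pole `τ` (`u(τ) ∈ Λ`) — half the order of the pole of
`x`. [folklore] -/
def poleOrder (f : CuspForm (Gamma0 N) 2) (τ : ℍ) : ℕ :=
  analyticOrderNatAt (fun w : ℂ ↦ eichlerIntegral f (ofComplex w) - eichlerIntegral f (ofComplex τ)) τ

/-- `poleOrder f τ ≥ 1` for `f ≠ 0`. [folklore] -/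
theorem one_le_poleOrder (hf : f ≠ 0) (τ : ℍ) : 1 ≤ poleOrder f τ := by
  have hz : 0 < (τ : ℂ).im := τ.im_pos
  have hfin := analyticOrderAt_eichlerIntegral_sub_ne_top f hf hz
  have han : AnalyticAt ℂ (fun w : ℂ ↦ eichlerIntegral f (ofComplex w) - eichlerIntegral f (ofComplex τ)) τ :=
    (analyticAt_eichlerIntegral_comp_ofComplex f hz).sub analyticAt_const
  have hne : analyticOrderAt (fun w : ℂ ↦ eichlerIntegral f (ofComplex w) - eichlerIntegral f (ofComplex τ)) τ ≠ 0 := by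
    rw [Ne, han.analyticOrderAt_eq_zero]; simp
  rw [poleOrder]
  by_contra hlt
  have h0 : analyticOrderNatAt (fun w : ℂ ↦ eichlerIntegral f (ofComplex w) - eichlerIntegral f (ofComplex τ)) τ = 0 := by
    omega
  apply hne
  rw [← Nat.cast_analyticOrderNatAt hfin, h0, Nat.cast_zero]

/-- **Orders at a pole**: if `u(τ) ∈ Λ` then `ord_τ F + 2m = ord_τ G`, `m = poleOrder f τ` (the
meromorphic order of `x = ℘_Λ∘u` at `τ` is `−2m`, `meromorphicOrderAt_weierstrassP_eichlerIntegral`,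
and `F = xG` on a punctured neighbourhood). [folklore] -/
theorem orderAt_add_eq_of_mem (h : IsXPresentation f L F G) (hf : f ≠ 0) {τ : ℍ}
    (hτ : eichlerIntegral f τ ∈ L.lattice) :
    orderAt (F : ModularForm (Gamma0 N) k) τ + 2 * poleOrder f τ = orderAt (G : ModularForm (Gamma0 N) k) τ := by
  have hF0 := h.numerator_ne_zero hf
  have hG0 := h.modularForm_ne_zero
  set z₀ : ℂ := (τ : ℂ) with hz₀
  have hz₀im : 0 < z₀.im := τ.im_pos
  have hτL : eichlerIntegral f (ofComplex z₀) ∈ L.lattice := by rwa [hz₀, ofComplex_apply]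
  set X : ℂ → ℂ := fun w ↦ ℘[L] (eichlerIntegral f (ofComplex w)) with hX
  set Fc : ℂ → ℂ := ⇑F ∘ ofComplex with hFc
  set Gc : ℂ → ℂ := ⇑G ∘ ofComplex with hGc
  -- `Fc = X·Gc` on a punctured neighbourhood of `z₀`
  obtain ⟨V, hV, hVuniq⟩ := exists_nhds_forall_eichlerIntegral_mem_imp_eq f hf L τ
  have hS : ((↑) : ℍ → ℂ) '' V ∈ 𝓝 z₀ := UpperHalfPlane.isOpenEmbedding_coe.image_mem_nhds.mpr hV
  have hev : Fc =ᶠ[𝓝[≠] z₀] X * Gc := by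
    rw [eventuallyEq_nhdsWithin_iff]
    filter_upwards [hS] with w hw hne
    obtain ⟨τ', hτ'V, rfl⟩ := hw
    have hτ'L : eichlerIntegral f (ofComplex (τ' : ℂ)) ∉ L.lattice := by
      intro hmem
      rw [ofComplex_apply] at hmem
      exact hne (by rw [Set.mem_singleton_iff, hVuniq τ' hτ'V hmem, hz₀])
    rw [hFc, h.apply_eq_mul hτ'L]
    rfl
  -- meromorphic / analytic data
  have hXmer : MeromorphicAt X z₀ := meromorphicAt_weierstrassP_eichlerIntegral f L hz₀im
  have hGan : AnalyticAt ℂ Gc z₀ := (isCuspFunction_one G).analyticAt_comp_ofComplex hz₀im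
  have hFan : AnalyticAt ℂ Fc z₀ := (isCuspFunction_one F).analyticAt_comp_ofComplex hz₀im
  have hordX := meromorphicOrderAt_weierstrassP_eichlerIntegral f hf L hz₀im hτL
  have hordF : meromorphicOrderAt Fc z₀ = ((orderAt (F : ModularForm (Gamma0 N) k) τ : ℤ) : WithTop ℤ) := by
    have h1 : analyticOrderAt Fc z₀ = (orderAt (F : ModularForm (Gamma0 N) k) τ : ℕ∞) := by
      rw [orderAt_eq hF0 τ]; rfl
    rw [hFan.meromorphicOrderAt_eq, h1, ENat.map_coe]
  have hordG : meromorphicOrderAt Gc z₀ = ((orderAt (G : ModularForm (Gamma0 N) k) τ : ℤ) : WithTop ℤ) := by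
    have h1 : analyticOrderAt Gc z₀ = (orderAt (G : ModularForm (Gamma0 N) k) τ : ℕ∞) := by
      rw [orderAt_eq hG0 τ]; rfl
    rw [hGan.meromorphicOrderAt_eq, h1, ENat.map_coe]
  have key : meromorphicOrderAt Fc z₀ = meromorphicOrderAt X z₀ + meromorphicOrderAt Gc z₀ := by
    rw [meromorphicOrderAt_congr hev, meromorphicOrderAt_mul hXmer hGan.meromorphicAt]
  rw [hordF, hordX, hordG, ← WithTop.coe_add, WithTop.coe_eq_coe] at key
  have hm : (poleOrder f τ : ℤ) = (analyticOrderNatAt (fun w : ℂ ↦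
      eichlerIntegral f (ofComplex w) - eichlerIntegral f (ofComplex z₀)) z₀ : ℕ) := by
    rw [poleOrder, hz₀]
  omega

/-- At a pole, `ord_τ F < ord_τ G`. [folklore] -/
theorem orderAt_lt_of_mem (h : IsXPresentation f L F G) (hf : f ≠ 0) {τ : ℍ}
    (hτ : eichlerIntegral f τ ∈ L.lattice) :
    orderAt (F : ModularForm (Gamma0 N) k) τ < orderAt (G : ModularForm (Gamma0 N) k) τ := by
  have h1 := h.orderAt_add_eq_of_mem hf hτ
  have h2 := one_le_poleOrder (f := f) hf τ
  omega

/-- **Pole of `x = F/G`**: if `u(τ) ∈ Λ` then `(F/G)⁻¹ ∈ m_{P_τ}`. [folklore] -/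
theorem pointValuation_xFn_inv_lt_one (h : IsXPresentation f L F G) (hf : f ≠ 0) {τ : ℍ}
    (hτ : eichlerIntegral f τ ∈ L.lattice) : pointValuation (N := N) τ h.xFn⁻¹ < 1 :=
  pointValuation_mkFn_inv_lt_one h.modularForm_ne_zero (h.numerator_ne_zero hf) (h.orderAt_lt_of_mem hf hτ)

/-- If `u(τ) ∈ Λ` then `F/G ∉ O_{P_τ}`. [folklore] -/
theorem xFn_notMem_pointPlace (h : IsXPresentation f L F G) (hf : f ≠ 0) {τ : ℍ}
    (hτ : eichlerIntegral f τ ∈ L.lattice) : h.xFn ∉ (pointPlace (N := N) τ).toValuationSubring := by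
  rw [xFn_def, mkFn_mem_pointPlace_iff h.modularForm_ne_zero (h.numerator_ne_zero hf), not_le]
  exact h.orderAt_lt_of_mem hf hτ

/-- **`F/G ∈ O_{P_τ}` iff `u(τ) ∉ Λ`.** [folklore] -/
theorem xFn_mem_pointPlace_iff (h : IsXPresentation f L F G) (hf : f ≠ 0) (τ : ℍ) :
    h.xFn ∈ (pointPlace (N := N) τ).toValuationSubring ↔ eichlerIntegral f τ ∉ L.lattice :=
  ⟨fun hm hτ ↦ h.xFn_notMem_pointPlace hf hτ hm, h.xFn_mem_pointPlace τ⟩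

/-- `x ≠ 0` in `K_N`. [folklore] -/
theorem xFn_ne_zero (h : IsXPresentation f L F G) (hf : f ≠ 0) : h.xFn ≠ 0 :=
  mkFn_ne_zero h.modularForm_ne_zero (h.numerator_ne_zero hf)

end IsXPresentation

/-- **Existence of a presentation** (restated with the predicate). [cite: ShimuraIATAF1971, §2.4] -/
theorem exists_isXPresentation (f : CuspForm (Gamma0 N) 2) (hf : f ≠ 0) (L : PeriodPair)
    (hΛ : ∀ x ∈ periodLattice f, x ∈ L.lattice) :
    ∃ (k : ℤ) (F G : CuspForm (Gamma0 N) k), 12 ≤ k ∧ IsXPresentation f L F G := by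
  obtain ⟨k, F, G, hk, hG, hFG⟩ := exists_presentation_gamma0 f hf L hΛ
  exact ⟨k, F, G, hk, hG, hFG⟩

end Literature.NumberTheory.EllipticCurves.ModularForms

end
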